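/-
Copyright (c) 2026 the pub-hodgecm-mathlib formalisation cell (harness21).  Prover seat hodgecm-mathlib-F0P3a-p08 (g19), 2026-09-02.  Road «S3-tree»∕«S3-ram» (LEAD F0P3a-plan (g12)
T11-41∕T11-52; owner p06 (g15)), row (e2)(b) «P-2-ram»: R2²-ram FILE 2c — the free row at a tamely ramified CM place IN THE NORM-CLASS CURRENCY (★ FILE 2 p847429 with its
∃-guard rewritten by A-p19 (g27)'s ★ (D2-γ)-ram token-level law).
-/
import Literature.NumberTheory.Rogawski1990.DepthZeroKappaTransferTypeTwoRamifiedRowTwoPlace   -- ★ p847429 (this seat) FILE 2: `ncard_selfDual_cyclic_typeTwo_ram_eq_of_model`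
import Literature.NumberTheory.Automorphic.TypeTwoSelfDualCyclicLawRamified                   -- ★ A-p19 (g27) (D2-γ)-ram CM heads: `exists_selfDual_cyclic_iff_rational_norm_of_eigenData_type{A,B}_of_ramified`
import HarnessLib

/-!
# The depth-zero κ-transfer, type (2), TAMELY RAMIFIED place: the free row at one place in the norm-class currency

Topic `NumberTheory/Rogawski1990`; namespace `Literature.NumberTheory.Rogawski1990`.  ONE THEOREM (no definition, no instance, no notation, no named fact, no `sorry`); kernel lane
`--supports stmt-HodgeConjecture-24833`.  Road «S3-tree», seeding wave «S3-ram», row (e2)(b) «P-2-ram» — R2²-ram FILE 2c.  Consumer: F0P3a-p07 (g13)'s (T2) G-side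
(`stub_T2G_bd`, `stub_T2G_reg`): the «favourable class» guard of ★ FILE 2 becomes A-p19 (g27)'s `σ_w`-NORM CONDITION on `d₀·det J·χ_λ(u)∕((1+u)²·χ_λ(−1))`
(`d₀ = ᵗσ(x₀)·J·x₀` the Gram value of the rational `u`-eigenvector, `χ_λ(X) = X² − tX + D`), whose Legendre reading is ★ `RamifiedPlaceNormClassReading`.
HONEST LABEL: HC_CM is proved only modulo the 2 remaining named inputs (hLiu418 24832, h413 24833) until rung 0 closes; unconditional local algebra, count-neutral.

THE MATHEMATICS.  ★ FILE 2 `ncard_selfDual_cyclic_typeTwo_ram_eq_of_model` counts the self-dual `τ`-cyclic lattices of a deep type-(2) unitary `τ` at a ramified CM place: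
`2·q^{(N+n−1)∕2}` (`N` odd) ∕ `(q+1)·q^{(N+n−2)∕2}` (`N` even) if one exists, `0` otherwise.  ★ (D2-γ)-ram (A-p19) says one exists iff
`∃ z ∈ L_w, z·σ_w z·(d₀·det J·(u² − tu + D)∕((1+u)²(1+t+D))) = 1`, given the unramified eigen-field package `(θ, s̃, ι′)`, the eigenvalue `λ = (t + yθ)∕2` with
`λ² − tλ + D = 0`, `|λ − 1| < 1`, `λ·s̃λ = 1`, `ι′λ ≠ λ` — all of which this file builds exactly as ★ FILE 2 did (★ (D2-α)-ram p847393: `y, ε₀`, the type bit `s̃θ = (−1)^{N+1}θ`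
and `λ·s̃λ = 1`; ★ Q3-unit ∕ ★ QM: the global model `M = L(√m₀)`; ★ p847266 (L1′)(L2′)(L3′): `θ, s′, ι′, Fix ι′ = ι₁L_w`).

References: [Rogawski1990] J. D. Rogawski, *Automorphic Representations of Unitary Groups in Three Variables* (1990), §4.9 Lemma 4.9.3 p. 56, Prop. 4.9.1 (b) p. 55;
[Kottwitz1986] R. E. Kottwitz, *Base change for unit elements of Hecke algebras*, Compositio Math. 60 (1986), §3; [Jacobowitz1962] R. Jacobowitz, *Hermitian forms over local
fields*, Amer. J. Math. 84 (1962), §5, §7.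
-/

set_option autoImplicit false

noncomputable section

open NumberField IsDedekindDomain Matrix Polynomial Finset ValuativeRel
open scoped MatrixGroups WithZero ValuativeRel

namespace Literature.NumberTheory.Rogawski1990

open Literature.NumberTheory.Automorphic Literature.NumberTheory.Automorphic.UnitaryGroup Literature.NumberTheory.NumberFields Literature.NumberTheory.LocalFields
open Literature.NumberTheory.Automorphic.SymmetricEigenframe

variable (L : Type) [Field L] [NumberField L] [IsCMField L] {v : HeightOneSpectrum (𝓞 ↥(maximalRealSubfield L))}

set_option synthInstance.maxHeartbeats 200000 in
set_option maxHeartbeats 3200000 in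
/-- **ROW 2 AT ONE RAMIFIED PLACE, IN THE NORM-CLASS CURRENCY.**  For a deep type-(2) unitary `τ` over the CM completion `E = L_w` at a place `w ∣ v` RAMIFIED in `L` with
`|2|_w = 1` (`J ∈ GL₃(𝒪_w)` `σ_w`-hermitian; `χ_τ = (X − u)(X² − tX + D)` integral, `σu·u = 1`, `DσD = 1`, `σt = tσD`, `u ≡ 1`, `t ≡ 2`, `ord_w(u² − tu + D) = n`,
`ord_w(t² − 4D) = 2N` with `1 ≤ N`, `t² − 4D` maximally non-square; cyclic vector `w₀`; rational `u`-eigenvector `x₀ ≠ 0` with Gram value `d₀ = ᵗσ(x₀)·J·x₀`):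
`#S(τ) = 2·q^{(N+n−1)∕2}` (`N` odd) ∕ `(q+1)·q^{(N+n−2)∕2}` (`N` even) if `d₀·det J·(u² − tu + D)∕((1+u)²(1+t+D))` is a `σ_w`-norm, and `0` otherwise (`q = N(v)`).
[cite: Rogawski1990, §4.9 Lemma 4.9.3 p. 56, Prop. 4.9.1 (b) p. 55] [cite: Kottwitz1986, §3] [cite: Jacobowitz1962, §5, §7] -/
theorem ncard_selfDual_cyclic_typeTwo_ram_eq_of_norm (w : PlacesOver L v) (hw : IsCMField.complexConj L • w.1 = w.1)
    (he : v.asIdeal.ramificationIdx' w.1.asIdeal ≠ 1) (hv2 : Valued.v (2 : w.1.adicCompletion L) = 1)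
    (J : GL (Fin 3) (w.1.adicCompletion L)) (hJ : J ∈ glInt 3 (w.1.adicCompletion L))
    (hJh : ((J : Matrix (Fin 3) (Fin 3) (w.1.adicCompletion L)).map (galAdicCompletionMap (L := L) (IsCMField.complexConj L) hw))ᵀ = J)
    (τ : Matrix (Fin 3) (Fin 3) (w.1.adicCompletion L))
    (hτU : (τ.map (galAdicCompletionMap (L := L) (IsCMField.complexConj L) hw))ᵀ * (J : Matrix (Fin 3) (Fin 3) (w.1.adicCompletion L)) * τ = J)
    (hint : ∀ i, τ.charpoly.coeff i ∈ 𝒪[w.1.adicCompletion L])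
    {u t D : w.1.adicCompletion L} (hχ : τ.charpoly = (X - C u) * (X ^ 2 - C t * X + C D))
    (hσu : galAdicCompletionMap (L := L) (IsCMField.complexConj L) hw u * u = 1)
    (hσD : D * galAdicCompletionMap (L := L) (IsCMField.complexConj L) hw D = 1)
    (hσt : galAdicCompletionMap (L := L) (IsCMField.complexConj L) hw t = t * galAdicCompletionMap (L := L) (IsCMField.complexConj L) hw D)
    (hu1 : Valued.v (u - 1) < 1) (ht2 : Valued.v (t - 2) < 1)
    {n N : ℕ} (hn : Valued.v (u * u - t * u + D) = WithZero.exp (-(n : ℤ)))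
    (hdisc : Valued.v (t ^ 2 - 4 * D) = WithZero.exp (-((2 * N : ℕ) : ℤ)))
    (hsq : ∀ z : w.1.adicCompletion L, Valued.v (t ^ 2 - 4 * D) ≤ Valued.v (t ^ 2 - 4 * D - z ^ 2)) (hN1 : 1 ≤ N)
    {w₀ : Fin 3 → w.1.adicCompletion L} (hK : IsUnit (Matrix.of fun i j : Fin 3 => ((τ ^ (j : ℕ)) *ᵥ w₀) i).det)
    {x₀ : Fin 3 → w.1.adicCompletion L} (hx₀ : τ *ᵥ x₀ = u • x₀) (hx₀0 : x₀ ≠ 0) :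
    ((∃ z : w.1.adicCompletion L, z * galAdicCompletionMap (L := L) (IsCMField.complexConj L) hw z *
        ((∑ k, ∑ i, galAdicCompletionMap (L := L) (IsCMField.complexConj L) hw (x₀ i) * (J : Matrix (Fin 3) (Fin 3) (w.1.adicCompletion L)) i k * x₀ k) *
          (J : Matrix (Fin 3) (Fin 3) (w.1.adicCompletion L)).det * ((u ^ 2 - t * u + D) / ((1 + u) ^ 2 * (1 + t + D)))) = 1) →
      {Λ : Submodule 𝒪[w.1.adicCompletion L] (Fin 3 → w.1.adicCompletion L) |
          (∃ g ∈ unitaryGroupOfForm (galAdicCompletionMap (L := L) (IsCMField.complexConj L) hw) (J : Matrix (Fin 3) (Fin 3) (w.1.adicCompletion L)),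
            Λ = Submodule.span 𝒪[w.1.adicCompletion L] (Set.range ((g : Matrix (Fin 3) (Fin 3) (w.1.adicCompletion L)))ᵀ)) ∧
          ∃ wv : Fin 3 → w.1.adicCompletion L, Λ = Submodule.span 𝒪[w.1.adicCompletion L] (Set.range fun j : Fin 3 => (τ ^ (j : ℕ)) *ᵥ wv)}.ncard =
        if Odd N then 2 * Ideal.absNorm v.asIdeal ^ ((N + n - 1) / 2) else (Ideal.absNorm v.asIdeal + 1) * Ideal.absNorm v.asIdeal ^ ((N + n - 2) / 2)) ∧
    ((¬ ∃ z : w.1.adicCompletion L, z * galAdicCompletionMap (L := L) (IsCMField.complexConj L) hw z *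
        ((∑ k, ∑ i, galAdicCompletionMap (L := L) (IsCMField.complexConj L) hw (x₀ i) * (J : Matrix (Fin 3) (Fin 3) (w.1.adicCompletion L)) i k * x₀ k) *
          (J : Matrix (Fin 3) (Fin 3) (w.1.adicCompletion L)).det * ((u ^ 2 - t * u + D) / ((1 + u) ^ 2 * (1 + t + D)))) = 1) →
      {Λ : Submodule 𝒪[w.1.adicCompletion L] (Fin 3 → w.1.adicCompletion L) |
          (∃ g ∈ unitaryGroupOfForm (galAdicCompletionMap (L := L) (IsCMField.complexConj L) hw) (J : Matrix (Fin 3) (Fin 3) (w.1.adicCompletion L)),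
            Λ = Submodule.span 𝒪[w.1.adicCompletion L] (Set.range ((g : Matrix (Fin 3) (Fin 3) (w.1.adicCompletion L)))ᵀ)) ∧
          ∃ wv : Fin 3 → w.1.adicCompletion L, Λ = Submodule.span 𝒪[w.1.adicCompletion L] (Set.range fun j : Fin 3 => (τ ^ (j : ℕ)) *ᵥ wv)}.ncard = 0) := by
  classical
  haveI : Algebra.IsQuadraticExtension ↥(maximalRealSubfield L) L := IsCMField.isQuadraticExtension L
  have hc1 : IsCMField.complexConj L ≠ 1 := IsCMField.complexConj_ne_one L
  set σw := galAdicCompletionMap (L := L) (IsCMField.complexConj L) hw with hσw_def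
  have hσσ := galAdicCompletionMap_galAdicCompletionMap_of_smul_eq (IsCMField.complexConj L) w hc1 hw
  have hσO := mem_integer_galAdicCompletionMap (IsCMField.complexConj L) v w hw
  have hσv' : ∀ x, Valued.v (σw x) = Valued.v x := fun x => valued_galAdicCompletionMap (L := L) (IsCMField.complexConj L) hw x
  have h20 : (2 : w.1.adicCompletion L) ≠ 0 := fun h => by rw [h, map_zero] at hv2; exact zero_ne_one hv2
  -- `|D − 1| < 1`: `4(D − 1) = (t − 2)(t + 2) − (t² − 4D)`
  have htv : Valued.v t ≤ 1 := by
    have h := Valued.v.map_add_le ht2.le hv2.le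
    rwa [sub_add_cancel] at h
  have h4v : Valued.v (4 : w.1.adicCompletion L) = 1 := by
    rw [show (4 : w.1.adicCompletion L) = 2 * 2 by norm_num, map_mul, hv2, mul_one]
  have hD1 : Valued.v (D - 1) < 1 := by
    have h4 : Valued.v (4 * (D - 1)) < 1 := by
      rw [show 4 * (D - 1) = (t - 2) * (t + 2) + -(t ^ 2 - 4 * D) by ring]
      refine (Valued.v.map_add _ _).trans_lt (max_lt ?_ ?_)
      · rw [map_mul]
        have ht2' : Valued.v (t + 2) ≤ 1 := (Valued.v.map_add _ _).trans (max_le htv hv2.le)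
        exact mul_lt_one_of_lt_of_le ht2 ht2'
      · rw [Valuation.map_neg, hdisc, ← WithZero.exp_zero]; exact WithZero.exp_lt_exp.2 (by omega)
    rwa [map_mul, h4v, one_mul] at h4
  -- ★ (D2-α)-ram: the skew square root and the type bit
  obtain ⟨y, ε₀, hns, hD, hN, hσy⟩ := exists_skew_sqrt_discriminant_of_ramified L w hw he hv2 hσD hσt hD1 hdisc hsq
  have hdv : Valued.v (toPlace v w ε₀) = 1 := by
    have h := hns 0 (by rw [map_zero]; exact zero_le_one)
    rwa [zero_mul, zero_sub, Valuation.map_neg] at h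
  have hdnsq : ¬ IsSquare (toPlace v w ε₀) := by
    rintro ⟨r, hr⟩
    have hr1 : Valued.v r ≤ 1 := by
      by_contra hlt
      rw [not_le] at hlt
      have h1 : (1 : WithZero (Multiplicative ℤ)) < Valued.v (toPlace v w ε₀) := by
        rw [hr, map_mul]; exact one_lt_mul'' hlt hlt
      exact absurd hdv h1.ne'
    have h := hns r hr1
    rw [← hr, sub_self, map_zero] at h
    exact zero_ne_one h
  have hεres : ∀ r : w.1.adicCompletion L, Valued.v r ≤ 1 → ¬ Valued.v (toPlace v w ε₀ - r ^ 2) < 1 := fun r hr hlt => by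
    have h := hns r hr
    rw [← Valuation.map_neg, neg_sub, sq] at hlt
    exact absurd h hlt.ne
  have hσd : σw (toPlace v w ε₀) = toPlace v w ε₀ := galAdicCompletionMap_toPlace (IsCMField.complexConj L) w w hw ε₀
  have hy0 : y ≠ 0 := fun h0 => by rw [h0, map_zero] at hN; exact WithZero.zero_ne_coe hN
  have hyv1 : Valued.v y < 1 := by
    rw [hN, ← WithZero.exp_zero]; exact WithZero.exp_lt_exp.2 (by omega)
  -- ★ Q3-unit ∕ ★ QM: the global model `M = L(√m₀)` of `L_w(√ε₀)`
  obtain ⟨m₀, hm₀, hsqm, hnsm⟩ := exists_ringOfIntegers_not_mem_isSquare_inv_mul_not_isSquare (v := w.1) hv2 hdv hdnsq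
  have hnsq : ¬ IsSquare ((m₀ : L)) := not_isSquare_of_not_isSquare_algebraMap (m₀ : L) hnsm
  haveI : Fact (Irreducible (X ^ 2 - C ((m₀ : L)) : L[X])) := ⟨irreducible_X_sq_sub_C_of_not_isSquare (m₀ : L) hnsq⟩
  haveI : NumberField (AdjoinRoot (X ^ 2 - C ((m₀ : L)) : L[X])) := numberField_adjoinRoot (m₀ : L)
  haveI : Algebra.IsQuadraticExtension L (AdjoinRoot (X ^ 2 - C ((m₀ : L)) : L[X])) := isQuadraticExtension_adjoinRoot (m₀ : L)
  obtain ⟨c₁, hc₁, -⟩ := exists_algEquiv_root_eq_neg (m₀ : L)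
  have hδ0 : AdjoinRoot.root (X ^ 2 - C ((m₀ : L)) : L[X]) ≠ 0 := root_X_sq_sub_C_ne_zero (m₀ : L)
  have hmδ : algebraMap L (AdjoinRoot (X ^ 2 - C ((m₀ : L)) : L[X])) (m₀ : L) = (AdjoinRoot.root (X ^ 2 - C ((m₀ : L)) : L[X])) ^ 2 :=
    (root_X_sq_sub_C_sq (m₀ : L)).symm
  obtain ⟨w₁⟩ : Nonempty (PlacesOver (AdjoinRoot (X ^ 2 - C ((m₀ : L)) : L[X])) w.1) := inferInstance
  set M : Type := AdjoinRoot (X ^ 2 - C ((m₀ : L)) : L[X]) with hMdef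
  -- ★ (D2-β)-ram part L: `θ`, coordinates, the involutions `s′`, `ι′`, and `Fix ι′ = ι₁ L_w`
  obtain ⟨θ, hθ, hθv, hcoord, hintK, hval⟩ := exists_sqrt_and_coord_of_unit M w.1 c₁ hc₁ hδ0 m₀ hmδ hm₀ hdv hdnsq hsqm hv2 w₁
  obtain ⟨s', ι', ⟨hs'ι, hs'θ, hs's', hs'O, hs'v⟩, ⟨hι'ι, hι'θ, hι'ι', hι'O, hι'v⟩, hcomm⟩ :=
    exists_involutions_of_unit M w.1 c₁ hc₁ hδ0 m₀ hmδ hm₀ hdv hdnsq hsqm hv2 w₁ σw hσσ hσd hσO hσv' hθ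
  have hθ0 : θ ≠ 0 := fun h0 => by rw [h0, map_zero] at hθv; exact zero_ne_one hθv
  have hfix : ∀ z : w₁.1.adicCompletion M, ι' z = z → ∃ x, toPlace w.1 w₁ x = z := fun z hz =>
    (map_eq_self_iff_exists_eq_toPlace M w.1 c₁ hc₁ hδ0 m₀ hmδ hdnsq hsqm hv2 w₁ hθ hθ0 ι' hι'ι hι'θ z).1 hz
  have hcoord' : ∀ z : w₁.1.adicCompletion M, ∃ pq : w.1.adicCompletion L × w.1.adicCompletion L,
      z = toPlace w.1 w₁ pq.1 + toPlace w.1 w₁ pq.2 * θ := fun z => (hcoord z).exists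
  -- the eigenvalue `λ = (t + yθ)∕2` and its four facts
  set e₂ : w.1.adicCompletion L := 2⁻¹ with he₂
  have h2e : e₂ * 2 = 1 := inv_mul_cancel₀ h20
  set lam : w₁.1.adicCompletion M := (toPlace w.1 w₁ t + toPlace w.1 w₁ y * θ) * toPlace w.1 w₁ e₂ with hlam_def
  have hι2 : toPlace w.1 w₁ e₂ * 2 = 1 := by rw [← map_ofNat (toPlace w.1 w₁) 2, ← map_mul, h2e, map_one]
  have hD' : 4 * toPlace w.1 w₁ D = toPlace w.1 w₁ t * toPlace w.1 w₁ t - toPlace w.1 w₁ y * toPlace w.1 w₁ y * toPlace w.1 w₁ (toPlace v w ε₀) := by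
    have h := congrArg (toPlace w.1 w₁) hD
    simp only [map_mul, map_sub, map_ofNat] at h
    exact h
  have hquad : lam ^ 2 - toPlace w.1 w₁ t * lam + toPlace w.1 w₁ D = 0 := by
    rw [hlam_def]
    linear_combination (toPlace w.1 w₁ e₂ ^ 2 * (toPlace w.1 w₁ y) ^ 2) * hθ + (toPlace w.1 w₁ e₂ ^ 2) * hD'
      + (toPlace w.1 w₁ e₂ * toPlace w.1 w₁ t ^ 2 + toPlace w.1 w₁ e₂ * toPlace w.1 w₁ t * (toPlace w.1 w₁ y * θ)
          - toPlace w.1 w₁ D * (2 * toPlace w.1 w₁ e₂ + 1)) * hι2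
  have hjv : ∀ x, Valued.v (toPlace w.1 w₁ x) = Valued.v x := fun x => by
    have h := hval x 0
    rwa [map_zero, zero_mul, add_zero, map_zero, max_eq_left zero_le] at h
  have hlam1v : Valued.v (lam - 1) < 1 := by
    have hE2v : Valued.v (toPlace w.1 w₁ e₂) = 1 := by
      have h := congrArg Valued.v h2e
      rw [map_mul, hv2, mul_one, map_one] at h
      rw [hjv, h]
    rw [show lam - 1 = (toPlace w.1 w₁ (t - 2) + toPlace w.1 w₁ y * θ) * toPlace w.1 w₁ e₂ by
      rw [map_sub, map_ofNat, hlam_def]; linear_combination hι2, map_mul, hE2v, mul_one]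
    refine (Valued.v.map_add _ _).trans_lt (max_lt ?_ ?_)
    · rw [hjv]; exact ht2
    · rw [map_mul, hjv, hθv, mul_one]; exact hyv1
  have hne : ι' lam ≠ lam := by
    intro h
    rw [hlam_def, map_mul, map_add, map_mul, hι'ι, hι'ι, hι'ι, hι'θ] at h
    have h2 : 2 * (toPlace w.1 w₁ y * θ * toPlace w.1 w₁ e₂) = 0 := by linear_combination -h
    rcases mul_eq_zero.1 ((mul_eq_zero.1 h2).resolve_left (by
      rw [← map_ofNat (toPlace w.1 w₁) 2]; exact (_root_.map_ne_zero _).2 h20)) with h3 | h3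
    · rcases mul_eq_zero.1 h3 with h4 | h4
      · exact (_root_.map_ne_zero (toPlace w.1 w₁)).2 hy0 h4
      · exact hθ0 h4
    · have : toPlace w.1 w₁ e₂ * 2 = 0 := by rw [h3, zero_mul]
      rw [hι2] at this; exact one_ne_zero this
  -- ★ (D2-γ)-ram (A-p19): the ∃-guard ⟺ the norm condition, per torus type
  have hiff : (∃ wv : Fin 3 → w.1.adicCompletion L, ∃ g ∈ unitaryGroupOfForm σw (J : Matrix (Fin 3) (Fin 3) (w.1.adicCompletion L)),
      Submodule.span 𝒪[w.1.adicCompletion L] (Set.range fun k : Fin 3 => (τ ^ (k : ℕ)) *ᵥ wv) =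
        Submodule.span 𝒪[w.1.adicCompletion L] (Set.range ((g : Matrix (Fin 3) (Fin 3) (w.1.adicCompletion L)))ᵀ)) ↔
      ∃ z : w.1.adicCompletion L, z * σw z *
        ((∑ k, ∑ i, σw (x₀ i) * (J : Matrix (Fin 3) (Fin 3) (w.1.adicCompletion L)) i k * x₀ k) *
          (J : Matrix (Fin 3) (Fin 3) (w.1.adicCompletion L)).det * ((u ^ 2 - t * u + D) / ((1 + u) ^ 2 * (1 + t + D)))) = 1 := by
    rcases Nat.even_or_odd N with hNe | hNo
    · -- type B: `σ_K = s′ ∘ ι′`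
      have hlam1 : lam * (s'.comp ι') lam = 1 :=
        mul_map_mul_eq_one_of_skew_sqrt_typeB σw (toPlace w.1 w₁) (s'.comp ι') (fun x => by rw [RingHom.comp_apply, hι'ι, hs'ι]) hNe hθ
          (by rw [RingHom.comp_apply, hι'θ, map_neg, hs'θ]) hD hσD hσt (by rw [hσy, hNe.neg_one_pow, one_mul]) h2e
      exact exists_selfDual_cyclic_iff_rational_norm_of_eigenData_typeB_of_ramified M (IsCMField.complexConj L) hc1 v w hw w₁ he hv2 hσd hdv hεres
        hθ hval hcoord' s' ι' hs'ι hs'θ hs's' hs'v hι'ι hι'θ hι'ι' hι'v hcomm hfix J hJ hJh τ hτU hχ hσu hu1 hx₀ hx₀0 hquad hlam1v hlam1 hne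
    · -- type A: `σ_K = s′`
      have hlam1 : lam * s' lam = 1 :=
        mul_map_mul_eq_one_of_skew_sqrt_typeA σw (toPlace w.1 w₁) s' hs'ι hNo hθ hs'θ hD hσD hσt
          (by rw [hσy, hNo.neg_one_pow, neg_mul, one_mul]) h2e
      exact exists_selfDual_cyclic_iff_rational_norm_of_eigenData_typeA_of_ramified M (IsCMField.complexConj L) hc1 v w hw w₁ he hv2 hσd hdv hεres
        hθ hval hcoord' s' ι' hs'ι hs'θ hs's' hs'v hι'ι hι'θ hι'ι' hι'v hcomm hfix J hJ hJh τ hτU hχ hσu hu1 hx₀ hx₀0 hquad hlam1v hlam1 hne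
  -- ★ FILE 2: the count under the ∃-guard
  obtain ⟨h₁, h₂⟩ := ncard_selfDual_cyclic_typeTwo_ram_eq_of_model L w hw he hv2 J hJ hJh τ hτU hint hχ hσu hσD hσt hu1 ht2 hn hN1 hK hns hD hσy hN
    c₁ hc₁ hδ0 m₀ hmδ hm₀ hsqm w₁
  exact ⟨fun h => h₁ (hiff.2 h), fun h => h₂ (fun hex => h (hiff.1 hex))⟩

end Literature.NumberTheory.Rogawski1990

end
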